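import Mathlib

/-!
# The Cayley transform of a unitary group

Algebraic part (any field `R` with a star, any finite index type `n`, any matrix `H`):
for `X` with `Xᴴ H + H X = 0` ("`H`-skew") and `1 + X` invertible, the Cayley transform
`cayley X = (1 - X) (1 + X)⁻¹` satisfies `gᴴ H g = H` (`cayley_isUnitary`); conversely for
`g` with `gᴴ H g = H` and `1 + g` invertible, `X := (1 - g)(1 + g)⁻¹` is `H`-skew
(`isSkew_cayleyInv`) and `cayley X = g` (`cayley_cayleyInv`, characteristic `≠ 2`).
Over `ℂ`: the Cayley map is continuous where `det (1 + X) ≠ 0` (`continuousAt_cayley`), that set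
is open, and `det (1 + t g)` vanishes for only finitely many `t` (`finite_setOf_det_one_add_smul_eq_zero`).
The density argument built on this is in `CayleyDensity.lean`.
-/

namespace HodgeRepro.Cayley

open Matrix

section Algebra

variable {R : Type*} [Field R] [StarRing R] {n : Type*} [Fintype n] [DecidableEq n]

/-- `X` is `H`-skew: `Xᴴ H + H X = 0` (the Lie algebra of the unitary group of `H`). -/
def IsSkewFor (H X : Matrix n n R) : Prop := Xᴴ * H + H * X = 0

/-- `g` is `H`-unitary: `gᴴ H g = H`. -/
def IsUnitaryFor (H g : Matrix n n R) : Prop := gᴴ * H * g = H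

/-- The Cayley transform `X ↦ (1 - X)(1 + X)⁻¹`. -/
noncomputable def cayley (X : Matrix n n R) : Matrix n n R := (1 - X) * (1 + X)⁻¹

/-- The inverse Cayley transform `g ↦ (1 - g)(1 + g)⁻¹` (the same formula). -/
noncomputable def cayleyInv (g : Matrix n n R) : Matrix n n R := (1 - g) * (1 + g)⁻¹

omit [DecidableEq n] in
/-- `Xᴴ H = -(H X)` for `H`-skew `X`. -/
theorem IsSkewFor.conjTranspose_mul {H X : Matrix n n R} (hX : IsSkewFor H X) :
    Xᴴ * H = -(H * X) :=
  eq_neg_of_add_eq_zero_left hX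

/-- `(1 - X)ᴴ H = H (1 + X)` for `H`-skew `X`. -/
theorem IsSkewFor.one_sub_conjTranspose_mul {H X : Matrix n n R} (hX : IsSkewFor H X) :
    (1 - X)ᴴ * H = H * (1 + X) := by
  rw [conjTranspose_sub, conjTranspose_one, sub_mul, one_mul, hX.conjTranspose_mul,
    sub_neg_eq_add, mul_add, mul_one]

/-- `(1 + X)ᴴ H = H (1 - X)` for `H`-skew `X`. -/
theorem IsSkewFor.one_add_conjTranspose_mul {H X : Matrix n n R} (hX : IsSkewFor H X) :
    (1 + X)ᴴ * H = H * (1 - X) := by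
  rw [conjTranspose_add, conjTranspose_one, add_mul, one_mul, hX.conjTranspose_mul,
    ← sub_eq_add_neg, mul_sub, mul_one]

/-- **The Cayley transform of an `H`-skew matrix is `H`-unitary** (`1 + X` invertible). -/
theorem cayley_isUnitary {H X : Matrix n n R} (hX : IsSkewFor H X) (hdet : IsUnit (1 + X).det) :
    IsUnitaryFor H (cayley X) := by
  unfold IsUnitaryFor cayley
  have hdet' : IsUnit (1 + X)ᴴ.det := by rw [det_conjTranspose, isUnit_star]; exact hdet
  have hc : (1 + X) * (1 - X) = (1 - X) * (1 + X) := by noncomm_ring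
  rw [conjTranspose_mul, conjTranspose_nonsing_inv]
  calc ((1 + X)ᴴ)⁻¹ * (1 - X)ᴴ * H * ((1 - X) * (1 + X)⁻¹)
      = ((1 + X)ᴴ)⁻¹ * ((1 - X)ᴴ * H) * (1 - X) * (1 + X)⁻¹ := by
        simp only [Matrix.mul_assoc]
    _ = ((1 + X)ᴴ)⁻¹ * (H * (1 + X)) * (1 - X) * (1 + X)⁻¹ := by
        rw [hX.one_sub_conjTranspose_mul]
    _ = ((1 + X)ᴴ)⁻¹ * H * ((1 - X) * ((1 + X) * (1 + X)⁻¹)) := by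
        simp only [Matrix.mul_assoc]
        rw [← Matrix.mul_assoc (1 + X) (1 - X), hc, Matrix.mul_assoc]
    _ = ((1 + X)ᴴ)⁻¹ * H * (1 - X) := by rw [mul_nonsing_inv _ hdet, mul_one]
    _ = ((1 + X)ᴴ)⁻¹ * ((1 + X)ᴴ * H) := by rw [hX.one_add_conjTranspose_mul, Matrix.mul_assoc]
    _ = H := by rw [← Matrix.mul_assoc, nonsing_inv_mul _ hdet', one_mul]

/-- For `H`-unitary `g` with `u := 1 + g` invertible: `(u⁻¹)ᴴ H + H u⁻¹ = H`. -/
theorem inv_conjTranspose_mul_add_mul_inv {H g : Matrix n n R} (hg : IsUnitaryFor H g)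
    (hdet : IsUnit (1 + g).det) :
    ((1 + g)⁻¹)ᴴ * H + H * (1 + g)⁻¹ = H := by
  unfold IsUnitaryFor at hg
  have hdet' : IsUnit (1 + g)ᴴ.det := by rw [det_conjTranspose, isUnit_star]; exact hdet
  have h1 : H * (1 + g) + (1 + g)ᴴ * H = (1 + g)ᴴ * H * (1 + g) := by
    have : (1 + g)ᴴ * H * (1 + g) = H + H * g + gᴴ * H + gᴴ * H * g := by
      rw [conjTranspose_add, conjTranspose_one]; noncomm_ring
    rw [this, hg, conjTranspose_add, conjTranspose_one]; noncomm_ring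
  calc ((1 + g)⁻¹)ᴴ * H + H * (1 + g)⁻¹
      = ((1 + g)⁻¹)ᴴ * (H * (1 + g) + (1 + g)ᴴ * H) * (1 + g)⁻¹ := by
        rw [mul_add, add_mul, Matrix.mul_assoc _ (H * (1 + g)), Matrix.mul_assoc H,
          mul_nonsing_inv _ hdet, mul_one, ← Matrix.mul_assoc ((1 + g)⁻¹)ᴴ,
          conjTranspose_nonsing_inv, nonsing_inv_mul _ hdet', one_mul]
    _ = ((1 + g)⁻¹)ᴴ * ((1 + g)ᴴ * H * (1 + g)) * (1 + g)⁻¹ := by rw [h1]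
    _ = H := by
        rw [conjTranspose_nonsing_inv, Matrix.mul_assoc, Matrix.mul_assoc,
          mul_nonsing_inv _ hdet, mul_one, ← Matrix.mul_assoc, nonsing_inv_mul _ hdet', one_mul]

omit [StarRing R] in
/-- `cayleyInv g = 2 • (1 + g)⁻¹ - 1`. -/
theorem cayleyInv_eq {g : Matrix n n R} (hdet : IsUnit (1 + g).det) :
    cayleyInv g = (2 : R) • (1 + g)⁻¹ - 1 := by
  unfold cayleyInv
  have h : (1 : Matrix n n R) - g = (2 : R) • (1 : Matrix n n R) - (1 + g) := by
    rw [two_smul]; abel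
  rw [h, sub_mul, smul_mul_assoc, one_mul, mul_nonsing_inv _ hdet]

/-- **The inverse Cayley transform of an `H`-unitary matrix is `H`-skew** (`1 + g` invertible). -/
theorem isSkew_cayleyInv {H g : Matrix n n R} (hg : IsUnitaryFor H g) (hdet : IsUnit (1 + g).det) :
    IsSkewFor H (cayleyInv g) := by
  unfold IsSkewFor
  rw [cayleyInv_eq hdet, conjTranspose_sub, conjTranspose_smul, conjTranspose_one, star_ofNat,
    sub_mul, mul_sub, one_mul, mul_one, smul_mul_assoc, mul_smul_comm]
  have h2 : (2 : R) • ((1 + g)⁻¹ᴴ * H) + (2 : R) • (H * (1 + g)⁻¹) = H + H := by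
    rw [← smul_add, inv_conjTranspose_mul_add_mul_inv hg hdet, two_smul]
  calc (2 : R) • ((1 + g)⁻¹ᴴ * H) - H + ((2 : R) • (H * (1 + g)⁻¹) - H)
      = ((2 : R) • ((1 + g)⁻¹ᴴ * H) + (2 : R) • (H * (1 + g)⁻¹)) - (H + H) := by abel
    _ = 0 := by rw [h2, sub_self]

omit [StarRing R] in
/-- **Cayley is a left inverse of `cayleyInv`**: `cayley (cayleyInv g) = g` (`1 + g` invertible,
characteristic `≠ 2`). -/
theorem cayley_cayleyInv [CharZero R] {g : Matrix n n R} (hdet : IsUnit (1 + g).det) :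
    cayley (cayleyInv g) = g := by
  unfold cayley
  rw [cayleyInv_eq hdet]
  have h2 : (2 : R) ≠ 0 := two_ne_zero
  have hinv : (1 + ((2 : R) • (1 + g)⁻¹ - 1))⁻¹ = (2 : R)⁻¹ • (1 + g) := by
    apply inv_eq_right_inv
    rw [add_sub_cancel, smul_mul_smul_comm, nonsing_inv_mul _ hdet, mul_inv_cancel₀ h2, one_smul]
  rw [hinv]
  have h1 : (1 : Matrix n n R) - ((2 : R) • (1 + g)⁻¹ - 1) = (2 : R) • (g * (1 + g)⁻¹) := by
    have hg' : g * (1 + g)⁻¹ = 1 - (1 + g)⁻¹ := by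
      have h := mul_nonsing_inv (1 + g) hdet
      rw [add_mul, one_mul] at h
      exact eq_sub_of_add_eq' h
    rw [hg', smul_sub, two_smul, two_smul]; abel
  rw [h1, smul_mul_smul_comm, mul_inv_cancel₀ h2, one_smul, Matrix.mul_assoc,
    nonsing_inv_mul _ hdet, mul_one]

/-- An `H`-unitary matrix is invertible when `H` is. -/
theorem IsUnitaryFor.isUnit_det {H g : Matrix n n R} (hg : IsUnitaryFor H g) (hH : IsUnit H.det) :
    IsUnit g.det := by
  unfold IsUnitaryFor at hg
  have h := congrArg Matrix.det hg
  rw [det_mul, det_mul, det_conjTranspose] at h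
  have h2 : (star g.det * g.det) * H.det = 1 * H.det := by
    rw [one_mul]
    calc (star g.det * g.det) * H.det = star g.det * H.det * g.det := by ring
      _ = H.det := h
  have h3 : star g.det * g.det = 1 := mul_right_cancel₀ hH.ne_zero h2
  exact IsUnit.of_mul_eq_one _ (by rw [mul_comm]; exact h3)

end Algebra

/-! ## Over `ℂ`: continuity of the Cayley map, and the scalar perturbation -/

section Complex

variable {n : Type*} [Fintype n] [DecidableEq n]

/-- `cayley X = (1 - X) * (det (1 + X))⁻¹ • adjugate (1 + X)`. -/
theorem cayley_eq_adjugate (X : Matrix n n ℂ) :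
    cayley X = (1 - X) * ((1 + X).det⁻¹ • (1 + X).adjugate) := by
  unfold cayley
  rw [Matrix.inv_def, Ring.inverse_eq_inv]

/-- The Cayley map is continuous at every `X` with `det (1 + X) ≠ 0`. -/
theorem continuousAt_cayley {X : Matrix n n ℂ} (h : (1 + X).det ≠ 0) :
    ContinuousAt (cayley : Matrix n n ℂ → Matrix n n ℂ) X := by
  have hG : Continuous fun q : Matrix n n ℂ × ℂ × Matrix n n ℂ => q.1 * (q.2.1 • q.2.2) :=
    continuous_fst.matrix_mul (continuous_fst.comp continuous_snd |>.smul
      (continuous_snd.comp continuous_snd))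
  have hF : ContinuousAt (fun Y : Matrix n n ℂ => ((1 - Y, ((1 + Y).det⁻¹, (1 + Y).adjugate)) :
      Matrix n n ℂ × ℂ × Matrix n n ℂ)) X := by
    refine ContinuousAt.prodMk ?_ (ContinuousAt.prodMk ?_ ?_)
    · exact (continuous_const.sub continuous_id).continuousAt
    · exact ((continuous_const.add continuous_id).matrix_det.continuousAt).inv₀ h
    · exact (continuous_const.add continuous_id).matrix_adjugate.continuousAt
  have : (cayley : Matrix n n ℂ → Matrix n n ℂ) =
      (fun q : Matrix n n ℂ × ℂ × Matrix n n ℂ => q.1 * (q.2.1 • q.2.2)) ∘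
        fun Y => (1 - Y, ((1 + Y).det⁻¹, (1 + Y).adjugate)) := by
    funext Y; exact cayley_eq_adjugate Y
  rw [this]
  exact hG.continuousAt.comp hF

/-- The set `{X | det (1 + X) ≠ 0}` is open. -/
theorem isOpen_det_one_add_ne_zero :
    IsOpen {X : Matrix n n ℂ | (1 + X).det ≠ 0} :=
  isOpen_ne_fun (continuous_const.add continuous_id).matrix_det continuous_const

/-- `det (1 + t • g)` is a polynomial in `t` which is `1` at `t = 0`; hence it vanishes for only
finitely many `t`. -/
theorem finite_setOf_det_one_add_smul_eq_zero (g : Matrix n n ℂ) :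
    {t : ℂ | (1 + t • g).det = 0}.Finite := by
  classical
  set P : Polynomial ℂ :=
    ((1 : Matrix n n (Polynomial ℂ)) + g.map fun a => Polynomial.C a * Polynomial.X).det with hP
  have heval : ∀ t : ℂ, Polynomial.eval t P = (1 + t • g).det := by
    intro t
    rw [hP, ← Polynomial.coe_evalRingHom, RingHom.map_det, RingHom.mapMatrix_apply,
      Matrix.map_add _ (map_add _), Matrix.map_one _ (map_zero _) (map_one _), Matrix.map_map]
    congr 2
    ext i j
    simp only [Function.comp, Matrix.map_apply, Polynomial.coe_evalRingHom, Polynomial.eval_mul,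
      Polynomial.eval_C, Polynomial.eval_X, Matrix.smul_apply, smul_eq_mul, mul_comm]
  have hP0 : P ≠ 0 := by
    intro h0
    have := heval 0
    rw [h0, Polynomial.eval_zero, zero_smul, add_zero, Matrix.det_one] at this
    exact zero_ne_one this
  have : {t : ℂ | (1 + t • g).det = 0} = {t | Polynomial.IsRoot P t} := by
    ext t; simp only [Set.mem_setOf_eq, Polynomial.IsRoot.def, heval]
  rw [this]
  exact Polynomial.finite_setOf_isRoot hP0

end Complex

end HodgeRepro.Cayley
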